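import Summits.Ventures.CertifiedQuantumChemistry.Rows.SpinSquaredPenaltyDuality
import HarnessLib

/-!
# Ventures/CertifiedQuantumChemistry — Rows/SpinSquaredPenaltyDualityT.lean: the free-multiplier statement
# at the THREE-INDEX rung — `sup_μ E_PQGT1T2′(Ĥ + μŜ²; n, n) = E_PQGT1T2′(2n, S = 0)`

HONEST FRAMING (verbatim): certified bounds for a stated model Hamiltonian in a stated basis; not a
claim about the real molecule beyond that model.

Seat rdm-B (gen 21), ROWS file: theorems only (no `def`, no notation), zero compute, nothing landed is
touched; the typer's adopt / refactor / retire word applies. The `PQGT1T2′` twin of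
`Rows/SpinSquaredPenaltyDuality.lean` (the DQG rung): with the SAME spin-free tables
`(h, g − μ·[q = r][p = s], h_nuc + μ·n(2 − n))` of `Ĥ + μŜ²` on the `N = 2n` sector and the same penalty
functional `n(2 − n) − ½ Y(Γ)` (`Rows/SpinSquaredPenalty.lean`), the singlet-restricted three-index value
`pqgT1T2pSingletEnergy` (the cell's `DQGT1T2′+S²` instances) is the supremum over the free multiplier `μ`
of the plain three-index values of `Ĥ + μŜ²` — `pqgT1T2pSectorEnergy` (the cell's `S_z`-sector `DQGT1T2′`
instances) and `pqgT1T2pEnergy` (`N`-programme). Same argument: the penalty is non-negative on the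
`PQGT1T2′`-feasible set (it is DQG-feasible), vanishes exactly on the singlet-feasible one (rdm-A's
`isDQGT1T2PrimeFeasibleSinglet_iff_spinFreeRow`), and the feasible set is compact
(`isCompact_setOf_isDQGT1T2PrimeFeasible`), so weak duality + a Cantor-intersection argument give the
supremum WITHOUT any constraint qualification.

* §1 `pqgT1T2pEnergy_le_pqgT1T2pSectorEnergy` (the sector programme has more rows), weak duality
  `pqgT1T2pEnergy_spinPenalty_le_pqgT1T2pSingletEnergy` / `pqgT1T2pSectorEnergy_spinPenalty_le_pqgT1T2pSingletEnergy`,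
  `monotone_pqgT1T2pEnergy_spinPenalty` / `monotone_pqgT1T2pSectorEnergy_spinPenalty`.
* §2 STRONG DUALITY: **`exists_pqgT1T2pEnergy_spinPenalty_gt`**, `isLUB_pqgT1T2pEnergy_spinPenalty`,
  `iSup_pqgT1T2pEnergy_spinPenalty`, `tendsto_pqgT1T2pEnergy_spinPenalty`, and the cell's sector form
  **`isLUB_pqgT1T2pSectorEnergy_spinPenalty`**, **`iSup_pqgT1T2pSectorEnergy_spinPenalty`**
  (`⨆_μ E_PQGT1T2′(Ĥ + μŜ²; n, n) = E_PQGT1T2′(2n, S = 0)`), **`tendsto_pqgT1T2pSectorEnergy_spinPenalty`**,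
  `le_pqgT1T2pSingletEnergy_iff_forall_exists_spinPenalty`.

READING as in the DQG file: the supremum / limit is what is proved; attainment at a finite `μ` is NOT
claimed. NOT here: rates, pinned instances, solver runs, certificates; no claim node / hint / row /
CERTIFIED cell depends on this file. Everything is PROVED (0 sorry, standard axioms); no definitions, no
named facts. Generator-B independence untouched (tree theorems only).

References: D. G. Luenberger, Y. Ye, *Linear and Nonlinear Programming* (Springer, 3rd ed. 2008) §13.1
(penalty methods); M. Nakata et al., J. Chem. Phys. 128 (2008) 164113 §II.A–C (the `PQGT1T2′` programme,
values as minima); D. A. Mazziotti, Adv. Chem. Phys. 134 (2007) ch. 3 §II.F.1 eqs. (96)–(98).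
Tree (REUSED): `Rows/SpinSquaredPenalty` (`re_rdmEnergy_spinPenalty`, `spinPenalty_re_nonneg`,
`spinPenalty_im_eq_zero`, `rdmEnergy_spinPenalty_of_isDQGFeasibleSinglet`); `pqgT1T2pEnergy(_le_rdmEnergy)`,
`pqgT1T2pEnergySet_nonempty`, `exists_isDQGT1T2PrimeFeasible_rdmEnergy_eq_pqgT1T2pEnergy`,
`isCompact_setOf_isDQGT1T2PrimeFeasible`, `isClosed_setOf_isDQGT1T2PrimeFeasible`, `continuous_rdmEnergy`,
`pqgT1T2pSectorEnergy(_le_rdmEnergy)`, `pqgT1T2pSectorEnergySet_nonempty`,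
`pqgT1T2pSingletEnergy(_le_rdmEnergy)`, `pqgT1T2pSingletEnergySet_nonempty`,
`IsDQGT1T2PrimeFeasibleSector.isDQGT1T2PrimeFeasible`, `IsDQGT1T2PrimeFeasibleSinglet.toIsDQGFeasibleSinglet`
(typer); `isDQGT1T2PrimeFeasibleSinglet_iff_spinFreeRow` (rdm-A). Mathlib:
`IsCompact.nonempty_iInter_of_sequence_nonempty_isCompact_isClosed`, `exists_nat_gt`, `tendsto_atTop_isLUB`,
`IsLUB.ciSup_eq`.
-/

noncomputable section

namespace Summit.Ventures.CertifiedQuantumChemistry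

open Matrix Finset Filter Topology
open Literature.MathematicalPhysics.QuantumLattice Literature.MathematicalPhysics.QuantumChemistry
open scoped ComplexOrder

variable {Λ : Type*} [LinearOrder Λ] [Fintype Λ]

/-! ### §1 Hierarchy, weak duality, monotonicity at the `PQGT1T2′` rung -/

section Weak

variable (h : Λ → Λ → ℂ) (g : Λ → Λ → Λ → Λ → ℂ) (hnuc : ℂ) {n : ℕ}

/-- **`E_PQGT1T2′(N = a + b) ≤ E_PQGT1T2′(a, b)`**: the sector programme has more rows (three-index rung
of `pqgEnergy_le_pqgSectorEnergy`). -/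
theorem pqgT1T2pEnergy_le_pqgT1T2pSectorEnergy {a b : ℕ} (ha : a ≤ Fintype.card Λ)
    (hb : b ≤ Fintype.card Λ) : pqgT1T2pEnergy h g hnuc (a + b) ≤ pqgT1T2pSectorEnergy h g hnuc a b := by
  refine le_csInf (pqgT1T2pSectorEnergySet_nonempty h g hnuc ha hb) ?_
  rintro E ⟨γ, Γ, hf, rfl⟩
  exact pqgT1T2pEnergy_le_rdmEnergy h g hnuc hf.isDQGT1T2PrimeFeasible

/-- **WEAK DUALITY, `N`-programme, three-index rung**: `E_PQGT1T2′(Ĥ + μŜ²; 2n) ≤ E_PQGT1T2′(2n, S = 0)`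
for every real `μ`. -/
theorem pqgT1T2pEnergy_spinPenalty_le_pqgT1T2pSingletEnergy (hn : n ≤ Fintype.card Λ) (μ : ℝ) :
    pqgT1T2pEnergy h (fun p q r s => g p q r s - (μ : ℂ) * (if q = r ∧ p = s then 1 else 0))
        (hnuc + (μ : ℂ) * ((n : ℂ) * (2 - (n : ℂ)))) (n + n) ≤ pqgT1T2pSingletEnergy h g hnuc n := by
  refine le_csInf (pqgT1T2pSingletEnergySet_nonempty h g hnuc hn) ?_
  rintro E ⟨γ, Γ, hf, rfl⟩
  have hle := pqgT1T2pEnergy_le_rdmEnergy h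
    (fun p q r s => g p q r s - (μ : ℂ) * (if q = r ∧ p = s then 1 else 0))
    (hnuc + (μ : ℂ) * ((n : ℂ) * (2 - (n : ℂ)))) hf.toIsDQGT1T2PrimeFeasibleSector.isDQGT1T2PrimeFeasible
  rwa [rdmEnergy_spinPenalty_of_isDQGFeasibleSinglet h g hnuc (μ : ℂ) hf.toIsDQGFeasibleSinglet] at hle

/-- **WEAK DUALITY, sector programme, three-index rung**:
`E_PQGT1T2′(Ĥ + μŜ²; n, n) ≤ E_PQGT1T2′(2n, S = 0)` for every real `μ`. -/
theorem pqgT1T2pSectorEnergy_spinPenalty_le_pqgT1T2pSingletEnergy (hn : n ≤ Fintype.card Λ) (μ : ℝ) :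
    pqgT1T2pSectorEnergy h (fun p q r s => g p q r s - (μ : ℂ) * (if q = r ∧ p = s then 1 else 0))
        (hnuc + (μ : ℂ) * ((n : ℂ) * (2 - (n : ℂ)))) n n ≤ pqgT1T2pSingletEnergy h g hnuc n := by
  refine le_csInf (pqgT1T2pSingletEnergySet_nonempty h g hnuc hn) ?_
  rintro E ⟨γ, Γ, hf, rfl⟩
  have hle := pqgT1T2pSectorEnergy_le_rdmEnergy h
    (fun p q r s => g p q r s - (μ : ℂ) * (if q = r ∧ p = s then 1 else 0))
    (hnuc + (μ : ℂ) * ((n : ℂ) * (2 - (n : ℂ)))) hf.toIsDQGT1T2PrimeFeasibleSector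
  rwa [rdmEnergy_spinPenalty_of_isDQGFeasibleSinglet h g hnuc (μ : ℂ) hf.toIsDQGFeasibleSinglet] at hle

/-- `E_PQGT1T2′(Ĥ + μŜ²; 2n) ≤ E_PQGT1T2′(Ĥ + μŜ²; n, n)`. -/
theorem pqgT1T2pEnergy_spinPenalty_le_pqgT1T2pSectorEnergy_spinPenalty (hn : n ≤ Fintype.card Λ) (μ : ℝ) :
    pqgT1T2pEnergy h (fun p q r s => g p q r s - (μ : ℂ) * (if q = r ∧ p = s then 1 else 0))
        (hnuc + (μ : ℂ) * ((n : ℂ) * (2 - (n : ℂ)))) (n + n) ≤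
      pqgT1T2pSectorEnergy h (fun p q r s => g p q r s - (μ : ℂ) * (if q = r ∧ p = s then 1 else 0))
        (hnuc + (μ : ℂ) * ((n : ℂ) * (2 - (n : ℂ)))) n n :=
  pqgT1T2pEnergy_le_pqgT1T2pSectorEnergy h _ _ hn hn

/-- **MONOTONICITY, `N`-programme, three-index rung**: `μ ↦ E_PQGT1T2′(Ĥ + μŜ²; 2n)` is non-decreasing. -/
theorem monotone_pqgT1T2pEnergy_spinPenalty (hn : n ≤ Fintype.card Λ) :
    Monotone fun μ : ℝ => pqgT1T2pEnergy h
      (fun p q r s => g p q r s - (μ : ℂ) * (if q = r ∧ p = s then 1 else 0))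
      (hnuc + (μ : ℂ) * ((n : ℂ) * (2 - (n : ℂ)))) (n + n) := by
  intro μ μ' hμ
  dsimp only
  refine le_csInf (pqgT1T2pEnergySet_nonempty h _ _
    (by rw [Fintype.card_lex, Fintype.card_prod, Fintype.card_fin]; omega)) ?_
  rintro E ⟨γ, Γ, hf, rfl⟩
  refine (pqgT1T2pEnergy_le_rdmEnergy h _ _ hf).trans ?_
  rw [re_rdmEnergy_spinPenalty, re_rdmEnergy_spinPenalty]
  exact add_le_add le_rfl (mul_le_mul_of_nonneg_right hμ (spinPenalty_re_nonneg hf.toIsDQGFeasible))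

/-- **MONOTONICITY, sector programme, three-index rung**: `μ ↦ E_PQGT1T2′(Ĥ + μŜ²; n, n)` is
non-decreasing. -/
theorem monotone_pqgT1T2pSectorEnergy_spinPenalty (hn : n ≤ Fintype.card Λ) :
    Monotone fun μ : ℝ => pqgT1T2pSectorEnergy h
      (fun p q r s => g p q r s - (μ : ℂ) * (if q = r ∧ p = s then 1 else 0))
      (hnuc + (μ : ℂ) * ((n : ℂ) * (2 - (n : ℂ)))) n n := by
  intro μ μ' hμ
  dsimp only
  refine le_csInf (pqgT1T2pSectorEnergySet_nonempty h _ _ hn hn) ?_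
  rintro E ⟨γ, Γ, hf, rfl⟩
  refine (pqgT1T2pSectorEnergy_le_rdmEnergy h _ _ hf).trans ?_
  rw [re_rdmEnergy_spinPenalty, re_rdmEnergy_spinPenalty]
  exact add_le_add le_rfl (mul_le_mul_of_nonneg_right hμ
    (spinPenalty_re_nonneg hf.isDQGT1T2PrimeFeasible.toIsDQGFeasible))

end Weak

/-! ### §2 Strong duality at the `PQGT1T2′` rung -/

section Strong

variable (h : Λ → Λ → ℂ) (g : Λ → Λ → Λ → Λ → ℂ) (hnuc : ℂ) {n : ℕ}

/-- **STRONG DUALITY (penalty convergence), three-index `N`-programme.** For every `ε > 0` some `μ` gives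
`E_PQGT1T2′(2n, S = 0) − ε < E_PQGT1T2′(Ĥ + μŜ²; N = 2n)`: the nested closed sets
`A_m = {x PQGT1T2′-feasible | E(x) + m·P(x) ≤ E_S − ε}` of the compact feasible set would otherwise share
a point (Cantor) of penalty `0` (Archimedes), singlet-feasible with energy `≤ E_S − ε` — contradiction. -/
theorem exists_pqgT1T2pEnergy_spinPenalty_gt (hn : n ≤ Fintype.card Λ) {ε : ℝ} (hε : 0 < ε) :
    ∃ μ : ℝ, pqgT1T2pSingletEnergy h g hnuc n - ε <
      pqgT1T2pEnergy h (fun p q r s => g p q r s - (μ : ℂ) * (if q = r ∧ p = s then 1 else 0))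
        (hnuc + (μ : ℂ) * ((n : ℂ) * (2 - (n : ℂ)))) (n + n) := by
  have hN : n + n ≤ Fintype.card (Orb Λ) := by
    rw [Fintype.card_lex, Fintype.card_prod, Fintype.card_fin]
    omega
  by_contra hcon
  simp only [not_exists, not_lt] at hcon
  set ES := pqgT1T2pSingletEnergy h g hnuc n with hES
  set E0 := pqgT1T2pEnergy h g hnuc (n + n) with hE0
  let P : Matrix (Orb Λ) (Orb Λ) ℂ × Matrix (Orb Λ × Orb Λ) (Orb Λ × Orb Λ) ℂ → ℝ := fun x =>
    ((n : ℂ) * (2 - (n : ℂ)) - (1 / 2 : ℂ) * ∑ σ : Fin 2, ∑ τ : Fin 2, ∑ p : Λ, ∑ q : Λ,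
      x.2 (orb p σ, orb q τ) (orb q σ, orb p τ)).re
  let E : Matrix (Orb Λ) (Orb Λ) ℂ × Matrix (Orb Λ × Orb Λ) (Orb Λ × Orb Λ) ℂ → ℝ := fun x =>
    (rdmEnergy h g hnuc x.1 x.2).re
  have hPcont : Continuous P := by
    refine Complex.continuous_re.comp (continuous_const.sub (continuous_const.mul ?_))
    exact continuous_finsetSum _ fun σ _ => continuous_finsetSum _ fun τ _ =>
      continuous_finsetSum _ fun p _ => continuous_finsetSum _ fun q _ => continuous_snd.matrix_elem _ _
  have hEcont : Continuous E := Complex.continuous_re.comp (continuous_rdmEnergy h g hnuc)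
  have hmin : ∀ m : ℕ, ∃ x : Matrix (Orb Λ) (Orb Λ) ℂ × Matrix (Orb Λ × Orb Λ) (Orb Λ × Orb Λ) ℂ,
      IsDQGT1T2PrimeFeasible (n + n) x.1 x.2 ∧ E x + m * P x ≤ ES - ε := by
    intro m
    obtain ⟨γ, Γ, hf, hval⟩ := exists_isDQGT1T2PrimeFeasible_rdmEnergy_eq_pqgT1T2pEnergy h
      (fun p q r s => g p q r s - ((m : ℝ) : ℂ) * (if q = r ∧ p = s then 1 else 0))
      (hnuc + ((m : ℝ) : ℂ) * ((n : ℂ) * (2 - (n : ℂ)))) hN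
    refine ⟨(γ, Γ), hf, ?_⟩
    have := hcon (m : ℝ)
    rw [← hval, re_rdmEnergy_spinPenalty] at this
    exact this
  let A : ℕ → Set (Matrix (Orb Λ) (Orb Λ) ℂ × Matrix (Orb Λ × Orb Λ) (Orb Λ × Orb Λ) ℂ) := fun m =>
    {x | IsDQGT1T2PrimeFeasible (n + n) x.1 x.2 ∧ E x + m * P x ≤ ES - ε}
  have hAcl : ∀ m, IsClosed (A m) := fun m =>
    (isClosed_setOf_isDQGT1T2PrimeFeasible (ι := Orb Λ) (n + n)).inter
      (isClosed_le (hEcont.add (continuous_const.mul hPcont)) continuous_const)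
  have hA0 : IsCompact (A 0) :=
    (isCompact_setOf_isDQGT1T2PrimeFeasible (ι := Orb Λ) (n + n)).of_isClosed_subset (hAcl 0)
      fun x hx => hx.1
  have hAd : ∀ m, A (m + 1) ⊆ A m := by
    rintro m x ⟨hxf, hxle⟩
    refine ⟨hxf, le_trans ?_ hxle⟩
    have hP := spinPenalty_re_nonneg hxf.toIsDQGFeasible
    push_cast
    nlinarith
  have hAne : ∀ m, (A m).Nonempty := fun m => by
    obtain ⟨x, hxf, hxle⟩ := hmin m
    exact ⟨x, hxf, hxle⟩
  obtain ⟨a, ha⟩ := IsCompact.nonempty_iInter_of_sequence_nonempty_isCompact_isClosed A hAd hAne hA0 hAcl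
  have haA : ∀ m, a ∈ A m := fun m => Set.mem_iInter.1 ha m
  have haf : IsDQGT1T2PrimeFeasible (n + n) a.1 a.2 := (haA 0).1
  have hE0a : E0 ≤ E a := pqgT1T2pEnergy_le_rdmEnergy h g hnuc haf
  have hPa : P a = 0 := by
    have hP0 := spinPenalty_re_nonneg haf.toIsDQGFeasible
    by_contra hne
    have hPpos : 0 < P a := lt_of_le_of_ne hP0 (Ne.symm hne)
    obtain ⟨m, hm⟩ := exists_nat_gt ((ES - ε - E0) / P a)
    have h1 : (m : ℝ) * P a ≤ ES - ε - E0 := by linarith [(haA m).2]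
    have h2 : (ES - ε - E0) / P a < (m : ℝ) := hm
    rw [div_lt_iff₀ hPpos] at h2
    linarith
  have hPa' : (n : ℂ) * (2 - (n : ℂ)) - (1 / 2 : ℂ) * ∑ σ : Fin 2, ∑ τ : Fin 2, ∑ p : Λ, ∑ q : Λ,
      a.2 (orb p σ, orb q τ) (orb q σ, orb p τ) = 0 :=
    Complex.ext (by rw [Complex.zero_re]; exact hPa)
      (by rw [Complex.zero_im]; exact spinPenalty_im_eq_zero haf.toIsDQGFeasible)
  have haS : IsDQGT1T2PrimeFeasibleSinglet n a.1 a.2 :=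
    (isDQGT1T2PrimeFeasibleSinglet_iff_spinFreeRow n a.1 a.2).2
      ⟨haf, by linear_combination (-2 : ℂ) * hPa'⟩
  have hEa : E a ≤ ES - ε := by simpa using (haA 0).2
  have hSa : ES ≤ E a := pqgT1T2pSingletEnergy_le_rdmEnergy h g hnuc haS
  linarith

/-- **`E_PQGT1T2′(2n, S = 0)` is the least upper bound of the penalised three-index `N`-programme values.** -/
theorem isLUB_pqgT1T2pEnergy_spinPenalty (hn : n ≤ Fintype.card Λ) :
    IsLUB (Set.range fun μ : ℝ => pqgT1T2pEnergy h
      (fun p q r s => g p q r s - (μ : ℂ) * (if q = r ∧ p = s then 1 else 0))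
      (hnuc + (μ : ℂ) * ((n : ℂ) * (2 - (n : ℂ)))) (n + n)) (pqgT1T2pSingletEnergy h g hnuc n) := by
  refine ⟨?_, fun b hb => ?_⟩
  · rintro _ ⟨μ, rfl⟩
    exact pqgT1T2pEnergy_spinPenalty_le_pqgT1T2pSingletEnergy h g hnuc hn μ
  · by_contra hlt
    obtain ⟨μ, hμ⟩ := exists_pqgT1T2pEnergy_spinPenalty_gt h g hnuc hn (sub_pos.2 (not_le.1 hlt))
    have := hb ⟨μ, rfl⟩
    linarith

/-- **`sup_μ E_PQGT1T2′(Ĥ + μŜ²; N = 2n) = E_PQGT1T2′(2n, S = 0)`.** -/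
theorem iSup_pqgT1T2pEnergy_spinPenalty (hn : n ≤ Fintype.card Λ) :
    ⨆ μ : ℝ, pqgT1T2pEnergy h (fun p q r s => g p q r s - (μ : ℂ) * (if q = r ∧ p = s then 1 else 0))
      (hnuc + (μ : ℂ) * ((n : ℂ) * (2 - (n : ℂ)))) (n + n) = pqgT1T2pSingletEnergy h g hnuc n :=
  (isLUB_pqgT1T2pEnergy_spinPenalty h g hnuc hn).ciSup_eq

/-- **Penalty convergence, three-index `N`-programme**: `E_PQGT1T2′(Ĥ + μŜ²; 2n) → E_PQGT1T2′(2n, S = 0)`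
as `μ → +∞`. -/
theorem tendsto_pqgT1T2pEnergy_spinPenalty (hn : n ≤ Fintype.card Λ) :
    Tendsto (fun μ : ℝ => pqgT1T2pEnergy h
      (fun p q r s => g p q r s - (μ : ℂ) * (if q = r ∧ p = s then 1 else 0))
      (hnuc + (μ : ℂ) * ((n : ℂ) * (2 - (n : ℂ)))) (n + n)) atTop (𝓝 (pqgT1T2pSingletEnergy h g hnuc n)) :=
  tendsto_atTop_isLUB (monotone_pqgT1T2pEnergy_spinPenalty h g hnuc hn)
    (isLUB_pqgT1T2pEnergy_spinPenalty h g hnuc hn)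

/-- **THE CELL'S FORM at the three-index rung: `sup_μ E_PQGT1T2′(Ĥ + μŜ²; n, n) = E_PQGT1T2′(2n, S = 0)`**
(the `DQGT1T2′+S²` value is the supremum over the free multiplier of the `S_z`-sector `DQGT1T2′` values of
`Ĥ + μŜ²`). -/
theorem isLUB_pqgT1T2pSectorEnergy_spinPenalty (hn : n ≤ Fintype.card Λ) :
    IsLUB (Set.range fun μ : ℝ => pqgT1T2pSectorEnergy h
      (fun p q r s => g p q r s - (μ : ℂ) * (if q = r ∧ p = s then 1 else 0))
      (hnuc + (μ : ℂ) * ((n : ℂ) * (2 - (n : ℂ)))) n n) (pqgT1T2pSingletEnergy h g hnuc n) := by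
  refine ⟨?_, fun b hb => ?_⟩
  · rintro _ ⟨μ, rfl⟩
    exact pqgT1T2pSectorEnergy_spinPenalty_le_pqgT1T2pSingletEnergy h g hnuc hn μ
  · by_contra hlt
    obtain ⟨μ, hμ⟩ := exists_pqgT1T2pEnergy_spinPenalty_gt h g hnuc hn (sub_pos.2 (not_le.1 hlt))
    have h1 := hb ⟨μ, rfl⟩
    have h2 := pqgT1T2pEnergy_spinPenalty_le_pqgT1T2pSectorEnergy_spinPenalty h g hnuc hn μ
    simp only at h1
    linarith

/-- `⨆_μ E_PQGT1T2′(Ĥ + μŜ²; n, n) = E_PQGT1T2′(2n, S = 0)`. -/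
theorem iSup_pqgT1T2pSectorEnergy_spinPenalty (hn : n ≤ Fintype.card Λ) :
    ⨆ μ : ℝ, pqgT1T2pSectorEnergy h (fun p q r s => g p q r s - (μ : ℂ) * (if q = r ∧ p = s then 1 else 0))
      (hnuc + (μ : ℂ) * ((n : ℂ) * (2 - (n : ℂ)))) n n = pqgT1T2pSingletEnergy h g hnuc n :=
  (isLUB_pqgT1T2pSectorEnergy_spinPenalty h g hnuc hn).ciSup_eq

/-- **Penalty convergence, three-index sector form**: `E_PQGT1T2′(Ĥ + μŜ²; n, n) → E_PQGT1T2′(2n, S = 0)`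
as `μ → +∞`. -/
theorem tendsto_pqgT1T2pSectorEnergy_spinPenalty (hn : n ≤ Fintype.card Λ) :
    Tendsto (fun μ : ℝ => pqgT1T2pSectorEnergy h
      (fun p q r s => g p q r s - (μ : ℂ) * (if q = r ∧ p = s then 1 else 0))
      (hnuc + (μ : ℂ) * ((n : ℂ) * (2 - (n : ℂ)))) n n) atTop (𝓝 (pqgT1T2pSingletEnergy h g hnuc n)) :=
  tendsto_atTop_isLUB (monotone_pqgT1T2pSectorEnergy_spinPenalty h g hnuc hn)
    (isLUB_pqgT1T2pSectorEnergy_spinPenalty h g hnuc hn)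

/-- **Bound form, three-index rung**: a real `c` is a singlet-restricted `PQGT1T2′` lower bound iff for
every `ε > 0` some `μ` makes `c − ε` a plain sector `PQGT1T2′` lower bound of `Ĥ + μŜ²`. -/
theorem le_pqgT1T2pSingletEnergy_iff_forall_exists_spinPenalty (hn : n ≤ Fintype.card Λ) (c : ℝ) :
    c ≤ pqgT1T2pSingletEnergy h g hnuc n ↔ ∀ ε > 0, ∃ μ : ℝ, c - ε ≤ pqgT1T2pSectorEnergy h
      (fun p q r s => g p q r s - (μ : ℂ) * (if q = r ∧ p = s then 1 else 0))
      (hnuc + (μ : ℂ) * ((n : ℂ) * (2 - (n : ℂ)))) n n := by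
  constructor
  · intro hc ε hε
    obtain ⟨μ, hμ⟩ := exists_pqgT1T2pEnergy_spinPenalty_gt h g hnuc hn hε
    exact ⟨μ, by linarith [pqgT1T2pEnergy_spinPenalty_le_pqgT1T2pSectorEnergy_spinPenalty h g hnuc hn μ]⟩
  · intro hc
    refine le_of_forall_pos_lt_add fun ε hε => ?_
    obtain ⟨μ, hμ⟩ := hc (ε / 2) (half_pos hε)
    linarith [pqgT1T2pSectorEnergy_spinPenalty_le_pqgT1T2pSingletEnergy h g hnuc hn μ]

end Strong

end Summit.Ventures.CertifiedQuantumChemistry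

end
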